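import Mathlib

/-!
# `MatrixDescartes` census — the TETRANOMIAL STAIRCASE LEMMA (kernel anchor of the «T4» window rows)

HONEST FRAMING.  Object-search cell `pub-symmetroid`; door-A item `Theses.LacunarySymmetroid.DoorA26 = PosRootLawAt 2 6 19`
(stmt-ValiantsHypothesis-19979; OPEN, typed, never asserted).  A hypothetical twenty `f = Σ_{t≤20} c_t x^{E_t}` (21 alternating
monomials, 20 distinct positive roots) leaves, after killing the 17 monomials outside a window of four consecutive monomials by Euler
twists (`card_posRoots_le_card_posRoots_twists`, the mechanism of the kernel's C25 `newton_cone`), a reduced TETRANOMIAL with three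
distinct positive roots.  Normalised, `T(x) = 1 − β x^a + γ x^b − x^c` (`0 < a < b < c`).  This file proves the elementary lemma that
turns «three distinct positive roots» into LINEAR rows under case splits on `γ` (val-sym-door-p4 g10's «T4 staircase rows», memo
DOOR-A26-P4G10 §2): the set of admissible `β` at fixed `γ` is bounded above by the upper double-root branch `β = M(γ)` and `M` is
non-decreasing — in the certificate-friendly form

* `tetranomial_upper_staircase` — if `T` has three distinct positive roots, `γ ≤ γ'`, and `(β', γ', ξ)` is an UPPER-BRANCH DOUBLE-ROOT
  POINT (`T'(ξ) = 0` for the tetranomial `T'` with coefficients `β', γ'`, its Euler twist `τ'(ξ) = 0`, and `b(b−a)γ'ξ^b ≤ c(c−a)ξ^c`,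
  i.e. `ξ` is the larger critical point), then `β ≤ β'`.

The hypotheses on `(β', γ', ξ)` are polynomial, so a replay checks them by rational arithmetic at a rational `ξ`; the other branch /
the `x ↦ 1/x` mirror is the same lemma for the reversed tetranomial (`tetranomial_reverse_card`).  Proof: Rolle for `x^{−a}T`, a «no dip»
lemma for the twist `τ` from the single sign change of `τ′` (mean value theorem twice), `τ_{γ'} ≥ τ_γ`, and `T_{β',γ'}(x₂) ≤ 0` at the
middle root.  Nothing here bears on `DoorA26`, on `MatrixDescartes` (18050) or on `VP ≠ VNP`.

[folklore] Elementary real analysis (Rolle, mean value theorem) for one explicit fewnomial.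
-/

-- `Summit.ValiantsHypothesis.ValiantsHypothesis.…` repeats a component by the D-0017 layout
-- (single-conjunct summit), which the `dupNamespace` linter flags; the name is mandated.
set_option linter.dupNamespace false

namespace Summit.ValiantsHypothesis.ValiantsHypothesis.Theorems.LacunarySymmetroidMatrixDescartes.Census.T4

open Polynomial Set

section Algebra

variable {a b c : ℕ}

/-- Evaluation of the normalised tetranomial. [folklore] -/
theorem eval_tet (β γ x : ℝ) : ((C 1 - C β * X ^ a + C γ * X ^ b - X ^ c : ℝ[X])).eval x = 1 - β * x ^ a + γ * x ^ b - x ^ c := by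
  simp

/-- Evaluation of its Euler twist `τ_γ = X·T′ − a·T = −a + (b−a)γX^b − (c−a)X^c`. [folklore] -/
theorem eval_twi (γ x : ℝ) : ((C (-(a : ℝ)) + C (((b : ℝ) - a) * γ) * X ^ b - C ((c : ℝ) - a) * X ^ c : ℝ[X])).eval x = -(a : ℝ) + ((b : ℝ) - a) * γ * x ^ b - ((c : ℝ) - a) * x ^ c := by
  simp

/-- Evaluation of the twist's derivative `τ′ = b(b−a)γX^{b−1} − c(c−a)X^{c−1}`. [folklore] -/
theorem eval_dtwi (γ x : ℝ) :
    ((C ((((b : ℝ) - a) * γ) * b) * X ^ (b - 1) - C (((c : ℝ) - a) * c) * X ^ (c - 1) : ℝ[X])).eval x = (((b : ℝ) - a) * γ * b) * x ^ (b - 1) - (((c : ℝ) - a) * c) * x ^ (c - 1) := by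
  simp

/-- `x · T'(x) − a · T(x) = τ(x)` (the Euler twist kills the `x^a` monomial). [this work] -/
theorem twist_identity (ha : 0 < a) (hb : 0 < b) (hc : 0 < c) (β γ x : ℝ) :
    x * (derivative ((C 1 - C β * X ^ a + C γ * X ^ b - X ^ c : ℝ[X]))).eval x - (a : ℝ) * ((C 1 - C β * X ^ a + C γ * X ^ b - X ^ c : ℝ[X])).eval x = ((C (-(a : ℝ)) + C (((b : ℝ) - a) * γ) * X ^ b - C ((c : ℝ) - a) * X ^ c : ℝ[X])).eval x := by
  have ea : x * x ^ (a - 1) = x ^ a := by rw [← pow_succ', Nat.sub_add_cancel ha]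
  have eb : x * x ^ (b - 1) = x ^ b := by rw [← pow_succ', Nat.sub_add_cancel hb]
  have ec : x * x ^ (c - 1) = x ^ c := by rw [← pow_succ', Nat.sub_add_cancel hc]
  simp only [derivative_sub, derivative_add, derivative_mul, derivative_C, derivative_X_pow, zero_mul,
    zero_add, eval_sub, eval_add, eval_mul, eval_C, eval_pow, eval_X, eval_natCast, eval_zero, map_natCast]
  rw [← ea, ← eb, ← ec]
  ring

/-- `τ' = dtwi`. [this work] -/
theorem derivative_twi (γ : ℝ) : derivative ((C (-(a : ℝ)) + C (((b : ℝ) - a) * γ) * X ^ b - C ((c : ℝ) - a) * X ^ c : ℝ[X])) = (C ((((b : ℝ) - a) * γ) * b) * X ^ (b - 1) - C (((c : ℝ) - a) * c) * X ^ (c - 1) : ℝ[X]) := by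
  simp only [derivative_sub, derivative_add, derivative_C, derivative_C_mul_X_pow, zero_add]

/-- The twist grows with `γ`: `τ_{γ'}(x) − τ_γ(x) = (b−a)(γ'−γ)x^b ≥ 0` for `γ ≤ γ'`, `a < b`, `x ≥ 0`. [this work] -/
theorem eval_twi_mono (hab : a < b) {γ γ' x : ℝ} (hγ : γ ≤ γ') (hx : 0 ≤ x) :
    ((C (-(a : ℝ)) + C (((b : ℝ) - a) * γ) * X ^ b - C ((c : ℝ) - a) * X ^ c : ℝ[X])).eval x ≤ ((C (-(a : ℝ)) + C (((b : ℝ) - a) * γ') * X ^ b - C ((c : ℝ) - a) * X ^ c : ℝ[X])).eval x := by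
  rw [eval_twi, eval_twi]
  have hba : (0 : ℝ) < (b : ℝ) - a := by
    have : (a : ℝ) < b := by exact_mod_cast hab
    linarith
  nlinarith [pow_nonneg hx b, mul_nonneg hba.le (pow_nonneg hx b)]

/-- **Single sign change of `τ'`.**  If `τ'(p₁) ≤ 0` and `0 < p₁ < p₂` then `τ'(p₂) < 0`
(`τ'(p) = p^{b−1}(b(b−a)γ − c(c−a)p^{c−b})` and `p ↦ p^{c−b}` is strictly increasing). [this work] -/
theorem dtwi_neg_of_nonpos (ha : 0 < a) (hab : a < b) (hbc : b < c) {γ p₁ p₂ : ℝ} (hp₁ : 0 < p₁) (hp : p₁ < p₂)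
    (h : ((C ((((b : ℝ) - a) * γ) * b) * X ^ (b - 1) - C (((c : ℝ) - a) * c) * X ^ (c - 1) : ℝ[X])).eval p₁ ≤ 0) : ((C ((((b : ℝ) - a) * γ) * b) * X ^ (b - 1) - C (((c : ℝ) - a) * c) * X ^ (c - 1) : ℝ[X])).eval p₂ < 0 := by
  rw [eval_dtwi] at h ⊢
  have hp₂ : 0 < p₂ := hp₁.trans hp
  have hL : (0 : ℝ) < (c : ℝ) * ((c : ℝ) - a) := by
    have h1 : (0 : ℝ) < c := by exact_mod_cast (ha.trans (hab.trans hbc))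
    have h2 : (a : ℝ) < c := by exact_mod_cast (hab.trans hbc)
    exact mul_pos h1 (by linarith)
  -- factor `p^{c−1} = p^{b−1} · p^{c−b}`
  have split : ∀ p : ℝ, p ^ (c - 1) = p ^ (b - 1) * p ^ (c - b) := by
    intro p; rw [← pow_add]; congr 1; omega
  rw [split] at h ⊢
  set K : ℝ := ((b : ℝ) - a) * γ * b
  have hq₁ : 0 < p₁ ^ (b - 1) := pow_pos hp₁ _
  have hq₂ : 0 < p₂ ^ (b - 1) := pow_pos hp₂ _
  -- from `h`: K ≤ c(c−a) p₁^{c−b}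
  have hL' : (0 : ℝ) < ((c : ℝ) - a) * c := by
    have h1 : (0 : ℝ) < c := by exact_mod_cast (ha.trans (hab.trans hbc))
    have h2 : (a : ℝ) < c := by exact_mod_cast (hab.trans hbc)
    exact mul_pos (by linarith) h1
  have h' : K ≤ ((c : ℝ) - a) * c * p₁ ^ (c - b) := by
    by_contra hcon
    push Not at hcon
    have : 0 < p₁ ^ (b - 1) * (K - ((c : ℝ) - a) * c * p₁ ^ (c - b)) := mul_pos hq₁ (by linarith)
    nlinarith
  have hmono : p₁ ^ (c - b) < p₂ ^ (c - b) := pow_lt_pow_left₀ hp hp₁.le (by omega)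
  have h'' : K < ((c : ℝ) - a) * c * p₂ ^ (c - b) := by nlinarith
  nlinarith [mul_pos hq₂ (sub_pos.mpr h'')]

end Algebra

section Analysis

variable {a b c : ℕ}

/-- Mean value theorem for a polynomial on `[u, v]`. [folklore] -/
theorem poly_mvt (f : ℝ[X]) {u v : ℝ} (huv : u < v) :
    ∃ p ∈ Ioo u v, (derivative f).eval p * (v - u) = f.eval v - f.eval u := by
  obtain ⟨p, hp, h⟩ := exists_hasDerivAt_eq_slope (fun x => f.eval x) (fun x => (derivative f).eval x) huv
    f.continuousOn (fun x _ => f.hasDerivAt x)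
  refine ⟨p, hp, ?_⟩
  rw [h, div_mul_cancel₀ _ (sub_ne_zero.mpr huv.ne')]

/-- **No dip.**  For the twist `τ`: if `0 < u < v < w` then `τ(v) ≥ min (τ u) (τ w)` — `τ` cannot go down and come back up, because
`τ'` changes sign at most once, from `+` to `−`. [this work] -/
theorem twi_no_dip (ha : 0 < a) (hab : a < b) (hbc : b < c) (γ : ℝ) {u v w : ℝ} (hu : 0 < u) (huv : u < v) (hvw : v < w) :
    min (((C (-(a : ℝ)) + C (((b : ℝ) - a) * γ) * X ^ b - C ((c : ℝ) - a) * X ^ c : ℝ[X])).eval u) (((C (-(a : ℝ)) + C (((b : ℝ) - a) * γ) * X ^ b - C ((c : ℝ) - a) * X ^ c : ℝ[X])).eval w) ≤ ((C (-(a : ℝ)) + C (((b : ℝ) - a) * γ) * X ^ b - C ((c : ℝ) - a) * X ^ c : ℝ[X])).eval v := by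
  by_contra hcon
  push Not at hcon
  have h1 : ((C (-(a : ℝ)) + C (((b : ℝ) - a) * γ) * X ^ b - C ((c : ℝ) - a) * X ^ c : ℝ[X])).eval v < ((C (-(a : ℝ)) + C (((b : ℝ) - a) * γ) * X ^ b - C ((c : ℝ) - a) * X ^ c : ℝ[X])).eval u := lt_of_lt_of_le hcon (min_le_left _ _)
  have h2 : ((C (-(a : ℝ)) + C (((b : ℝ) - a) * γ) * X ^ b - C ((c : ℝ) - a) * X ^ c : ℝ[X])).eval v < ((C (-(a : ℝ)) + C (((b : ℝ) - a) * γ) * X ^ b - C ((c : ℝ) - a) * X ^ c : ℝ[X])).eval w := lt_of_lt_of_le hcon (min_le_right _ _)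
  obtain ⟨p₁, hp₁, e₁⟩ := poly_mvt ((C (-(a : ℝ)) + C (((b : ℝ) - a) * γ) * X ^ b - C ((c : ℝ) - a) * X ^ c : ℝ[X])) huv
  obtain ⟨p₂, hp₂, e₂⟩ := poly_mvt ((C (-(a : ℝ)) + C (((b : ℝ) - a) * γ) * X ^ b - C ((c : ℝ) - a) * X ^ c : ℝ[X])) hvw
  rw [derivative_twi] at e₁ e₂
  have hd₁ : ((C ((((b : ℝ) - a) * γ) * b) * X ^ (b - 1) - C (((c : ℝ) - a) * c) * X ^ (c - 1) : ℝ[X])).eval p₁ < 0 := by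
    by_contra hc'
    push Not at hc'
    have : 0 ≤ ((C ((((b : ℝ) - a) * γ) * b) * X ^ (b - 1) - C (((c : ℝ) - a) * c) * X ^ (c - 1) : ℝ[X])).eval p₁ * (v - u) := mul_nonneg hc' (by linarith)
    rw [e₁] at this
    linarith
  have hd₂ : 0 < ((C ((((b : ℝ) - a) * γ) * b) * X ^ (b - 1) - C (((c : ℝ) - a) * c) * X ^ (c - 1) : ℝ[X])).eval p₂ := by
    by_contra hc'
    push Not at hc'
    have : ((C ((((b : ℝ) - a) * γ) * b) * X ^ (b - 1) - C (((c : ℝ) - a) * c) * X ^ (c - 1) : ℝ[X])).eval p₂ * (w - v) ≤ 0 := mul_nonpos_of_nonpos_of_nonneg hc' (by linarith)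
    rw [e₂] at this
    linarith
  have hp : p₁ < p₂ := hp₁.2.trans hp₂.1
  have := dtwi_neg_of_nonpos ha hab hbc (hu.trans hp₁.1) hp hd₁.le
  linarith

/-- Rolle for `x^{−a}·T` between two positive roots of `T`: a root of the twist `τ` strictly in between. [folklore] -/
theorem exists_twi_root_between (ha : 0 < a) (hb : 0 < b) (hc : 0 < c) (β γ : ℝ) {x y : ℝ} (hx : 0 < x) (hxy : x < y)
    (hTx : ((C 1 - C β * X ^ a + C γ * X ^ b - X ^ c : ℝ[X])).eval x = 0) (hTy : ((C 1 - C β * X ^ a + C γ * X ^ b - X ^ c : ℝ[X])).eval y = 0) :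
    ∃ z ∈ Ioo x y, ((C (-(a : ℝ)) + C (((b : ℝ) - a) * γ) * X ^ b - C ((c : ℝ) - a) * X ^ c : ℝ[X])).eval z = 0 := by
  set f := (C 1 - C β * X ^ a + C γ * X ^ b - X ^ c : ℝ[X]) with hf
  have hder : ∀ u ∈ Ioo x y, HasDerivAt (fun u => f.eval u * Real.exp (-(a : ℝ) * Real.log u))
      ((derivative f).eval u * Real.exp (-(a : ℝ) * Real.log u) +
        f.eval u * (Real.exp (-(a : ℝ) * Real.log u) * (-(a : ℝ) * u⁻¹))) u := by
    intro u hu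
    have hu0 : u ≠ 0 := (hx.trans hu.1).ne'
    exact (f.hasDerivAt u).mul ((Real.hasDerivAt_log hu0).const_mul (-(a : ℝ))).exp
  have hcont : ContinuousOn (fun u => f.eval u * Real.exp (-(a : ℝ) * Real.log u)) (Icc x y) := by
    refine f.continuousOn.mul (Real.continuous_exp.comp_continuousOn
      (continuousOn_const.mul (Real.continuousOn_log.mono ?_)))
    intro u hu; exact (hx.trans_le hu.1).ne'
  obtain ⟨z, hz, hz0⟩ := exists_hasDerivAt_eq_zero hxy hcont (by rw [hTx, hTy, zero_mul, zero_mul]) hder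
  have hz0' : 0 < z := hx.trans hz.1
  refine ⟨z, hz, ?_⟩
  rw [← twist_identity ha hb hc β γ z]
  have hexp : 0 < Real.exp (-(a : ℝ) * Real.log z) := Real.exp_pos _
  have key : Real.exp (-(a : ℝ) * Real.log z) * (z * (derivative f).eval z - (a : ℝ) * f.eval z)
      = ((derivative f).eval z * Real.exp (-(a : ℝ) * Real.log z) +
          f.eval z * (Real.exp (-(a : ℝ) * Real.log z) * (-(a : ℝ) * z⁻¹))) * z := by
    field_simp
    ring
  rw [hz0, zero_mul] at key
  rcases mul_eq_zero.mp key with h | h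
  · exact absurd h hexp.ne'
  · exact h

/-- Mean value theorem for `x^{−a}·g` on `[u, v] ⊂ (0,∞)` in twist form: if the twist `x g' − a g` is `≥ 0` on `(u, v)` then
`g(u)/u^a ≤ g(v)/v^a`. [folklore] -/
theorem div_pow_le_of_twist_nonneg (g : ℝ[X]) {u v : ℝ} (hu : 0 < u) (huv : u < v)
    (htw : ∀ p ∈ Ioo u v, 0 ≤ p * (derivative g).eval p - (a : ℝ) * g.eval p) :
    g.eval u * Real.exp (-(a : ℝ) * Real.log u) ≤ g.eval v * Real.exp (-(a : ℝ) * Real.log v) := by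
  have hder : ∀ p ∈ Ioo u v, HasDerivAt (fun p => g.eval p * Real.exp (-(a : ℝ) * Real.log p))
      ((derivative g).eval p * Real.exp (-(a : ℝ) * Real.log p) +
        g.eval p * (Real.exp (-(a : ℝ) * Real.log p) * (-(a : ℝ) * p⁻¹))) p := by
    intro p hp
    have hp0 : p ≠ 0 := (hu.trans hp.1).ne'
    exact (g.hasDerivAt p).mul ((Real.hasDerivAt_log hp0).const_mul (-(a : ℝ))).exp
  have hcont : ContinuousOn (fun p => g.eval p * Real.exp (-(a : ℝ) * Real.log p)) (Icc u v) := by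
    refine g.continuousOn.mul (Real.continuous_exp.comp_continuousOn
      (continuousOn_const.mul (Real.continuousOn_log.mono ?_)))
    intro p hp; exact (hu.trans_le hp.1).ne'
  obtain ⟨p, hp, e⟩ := exists_hasDerivAt_eq_slope _ _ huv hcont hder
  have hp0 : 0 < p := hu.trans hp.1
  have hexp : 0 < Real.exp (-(a : ℝ) * Real.log p) := Real.exp_pos _
  have hval : 0 ≤ (derivative g).eval p * Real.exp (-(a : ℝ) * Real.log p) +
      g.eval p * (Real.exp (-(a : ℝ) * Real.log p) * (-(a : ℝ) * p⁻¹)) := by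
    have e2 : (derivative g).eval p * Real.exp (-(a : ℝ) * Real.log p) +
        g.eval p * (Real.exp (-(a : ℝ) * Real.log p) * (-(a : ℝ) * p⁻¹))
        = Real.exp (-(a : ℝ) * Real.log p) * p⁻¹ * (p * (derivative g).eval p - (a : ℝ) * g.eval p) := by
      field_simp
      ring
    rw [e2]
    exact mul_nonneg (mul_nonneg hexp.le (inv_nonneg.mpr hp0.le)) (htw p hp)
  rw [e] at hval
  have := (div_nonneg_iff.mp hval)
  rcases this with ⟨hnum, _⟩ | ⟨_, hden⟩
  · linarith
  · linarith [sub_pos.mpr huv]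

/-- **TETRANOMIAL UPPER STAIRCASE LEMMA.**  Let `0 < a < b < c` and let `T(x) = 1 − βx^a + γx^b − x^c` have three distinct positive
roots `x₁ < x₂ < x₃`.  Let `γ ≤ γ'` and let `(β', γ', ξ)` be an upper-branch double-root point: `ξ > 0`,
`T_{β',γ'}(ξ) = 0`, `τ_{γ'}(ξ) = 0` (the Euler twist, equivalently `T'_{β',γ'}(ξ) = 0`), and `b(b−a)γ'ξ^b ≤ c(c−a)ξ^c` (`ξ` is the
larger critical point).  Then `β ≤ β'`.  This is the row «`γ ≤ γ_hi ⇒ β ≤ M(γ_hi)`» of the T4 staircase, with `M(γ_hi)` presented by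
its rational branch point. [this work] -/
theorem tetranomial_upper_staircase (ha : 0 < a) (hab : a < b) (hbc : b < c)
    (β γ β' γ' ξ x₁ x₂ x₃ : ℝ) (hx₁ : 0 < x₁) (h12 : x₁ < x₂) (h23 : x₂ < x₃)
    (hT₁ : ((C 1 - C β * X ^ a + C γ * X ^ b - X ^ c : ℝ[X])).eval x₁ = 0) (hT₂ : ((C 1 - C β * X ^ a + C γ * X ^ b - X ^ c : ℝ[X])).eval x₂ = 0) (hT₃ : ((C 1 - C β * X ^ a + C γ * X ^ b - X ^ c : ℝ[X])).eval x₃ = 0)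
    (hγ : γ ≤ γ') (hξ : 0 < ξ)
    (hD₁ : ((C 1 - C β' * X ^ a + C γ' * X ^ b - X ^ c : ℝ[X])).eval ξ = 0) (hD₂ : ((C (-(a : ℝ)) + C (((b : ℝ) - a) * γ') * X ^ b - C ((c : ℝ) - a) * X ^ c : ℝ[X])).eval ξ = 0)
    (hD₃ : (b : ℝ) * ((b : ℝ) - a) * γ' * ξ ^ b ≤ (c : ℝ) * ((c : ℝ) - a) * ξ ^ c) :
    β ≤ β' := by
  have hb : 0 < b := ha.trans hab
  have hc : 0 < c := hb.trans hbc
  have hx₂ : 0 < x₂ := hx₁.trans h12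
  -- Step 1: roots of the twist interlace the roots of `T`
  obtain ⟨ρ₁, hρ₁, hτ₁⟩ := exists_twi_root_between ha hb hc β γ hx₁ h12 hT₁ hT₂
  obtain ⟨ρ₂, hρ₂, hτ₂⟩ := exists_twi_root_between ha hb hc β γ hx₂ h23 hT₂ hT₃
  have hρ₁0 : 0 < ρ₁ := hx₁.trans hρ₁.1
  -- Step 2: `τ_γ(x₂) > 0`
  have hτx₂ : 0 < ((C (-(a : ℝ)) + C (((b : ℝ) - a) * γ) * X ^ b - C ((c : ℝ) - a) * X ^ c : ℝ[X])).eval x₂ := by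
    have hge : 0 ≤ ((C (-(a : ℝ)) + C (((b : ℝ) - a) * γ) * X ^ b - C ((c : ℝ) - a) * X ^ c : ℝ[X])).eval x₂ := by
      have := twi_no_dip ha hab hbc γ hρ₁0 hρ₁.2 hρ₂.1
      rw [hτ₁, hτ₂, min_self] at this
      exact this
    rcases hge.lt_or_eq with h | h
    · exact h
    · -- `τ(x₂) = 0`: Rolle for `τ` on `[ρ₁, x₂]` and `[x₂, ρ₂]` gives two roots of `τ'`, impossible
      exfalso
      obtain ⟨q₁, hq₁, e₁⟩ := poly_mvt ((C (-(a : ℝ)) + C (((b : ℝ) - a) * γ) * X ^ b - C ((c : ℝ) - a) * X ^ c : ℝ[X])) hρ₁.2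
      obtain ⟨q₂, hq₂, e₂⟩ := poly_mvt ((C (-(a : ℝ)) + C (((b : ℝ) - a) * γ) * X ^ b - C ((c : ℝ) - a) * X ^ c : ℝ[X])) hρ₂.1
      rw [derivative_twi, ← h, hτ₁, sub_self] at e₁
      rw [derivative_twi, hτ₂, ← h, sub_self] at e₂
      have hd₁ : ((C ((((b : ℝ) - a) * γ) * b) * X ^ (b - 1) - C (((c : ℝ) - a) * c) * X ^ (c - 1) : ℝ[X])).eval q₁ = 0 := by
        rcases mul_eq_zero.mp e₁ with h' | h'
        · exact h'
        · linarith [hq₁.1, hq₁.2]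
      have hd₂ : ((C ((((b : ℝ) - a) * γ) * b) * X ^ (b - 1) - C (((c : ℝ) - a) * c) * X ^ (c - 1) : ℝ[X])).eval q₂ = 0 := by
        rcases mul_eq_zero.mp e₂ with h' | h'
        · exact h'
        · linarith [hq₂.1, hq₂.2]
      have := dtwi_neg_of_nonpos ha hab hbc (hρ₁0.trans hq₁.1) (hq₁.2.trans hq₂.1) hd₁.le
      linarith
  -- Step 3: `τ_{γ'}(x₂) > 0`, hence `x₂ < ξ`
  have hτ'x₂ : 0 < ((C (-(a : ℝ)) + C (((b : ℝ) - a) * γ') * X ^ b - C ((c : ℝ) - a) * X ^ c : ℝ[X])).eval x₂ := lt_of_lt_of_le hτx₂ (eval_twi_mono hab hγ hx₂.le)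
  have hD₃' : ((C ((((b : ℝ) - a) * γ') * b) * X ^ (b - 1) - C (((c : ℝ) - a) * c) * X ^ (c - 1) : ℝ[X])).eval ξ ≤ 0 := by
    have eb : ξ ^ b = ξ ^ (b - 1) * ξ := by rw [← pow_succ, Nat.sub_add_cancel hb]
    have ec : ξ ^ c = ξ ^ (c - 1) * ξ := by rw [← pow_succ, Nat.sub_add_cancel hc]
    have e1 : ((C ((((b : ℝ) - a) * γ') * b) * X ^ (b - 1) - C (((c : ℝ) - a) * c) * X ^ (c - 1) : ℝ[X])).eval ξ * ξ
        = (b : ℝ) * ((b : ℝ) - a) * γ' * ξ ^ b - (c : ℝ) * ((c : ℝ) - a) * ξ ^ c := by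
      rw [eval_dtwi, eb, ec]; ring
    have h0 : ((C ((((b : ℝ) - a) * γ') * b) * X ^ (b - 1) - C (((c : ℝ) - a) * c) * X ^ (c - 1) : ℝ[X])).eval ξ * ξ ≤ 0 := by rw [e1]; linarith
    by_contra hcon; push Not at hcon; nlinarith [mul_pos hcon hξ]
  have hx₂ξ : x₂ < ξ := by
    by_contra hcon
    push Not at hcon
    rcases hcon.lt_or_eq with hlt | heq
    · obtain ⟨p, hp, e⟩ := poly_mvt ((C (-(a : ℝ)) + C (((b : ℝ) - a) * γ') * X ^ b - C ((c : ℝ) - a) * X ^ c : ℝ[X])) hlt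
      rw [derivative_twi, hD₂] at e
      have hdp : 0 < ((C ((((b : ℝ) - a) * γ') * b) * X ^ (b - 1) - C (((c : ℝ) - a) * c) * X ^ (c - 1) : ℝ[X])).eval p := by
        by_contra hc'
        push Not at hc'
        have : ((C ((((b : ℝ) - a) * γ') * b) * X ^ (b - 1) - C (((c : ℝ) - a) * c) * X ^ (c - 1) : ℝ[X])).eval p * (x₂ - ξ) ≤ 0 := mul_nonpos_of_nonpos_of_nonneg hc' (by linarith)
        rw [e] at this
        linarith
      have := dtwi_neg_of_nonpos ha hab hbc hξ hp.1 hD₃'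
      linarith
    · rw [heq] at hD₂; linarith
  -- Step 4: `τ_{γ'} ≥ 0` on `(x₂, ξ)`
  have hτ'pos : ∀ p ∈ Ioo x₂ ξ, 0 ≤ ((C (-(a : ℝ)) + C (((b : ℝ) - a) * γ') * X ^ b - C ((c : ℝ) - a) * X ^ c : ℝ[X])).eval p := by
    intro p hp
    have := twi_no_dip ha hab hbc γ' hx₂ hp.1 hp.2
    rw [hD₂] at this
    exact le_trans (le_min hτ'x₂.le le_rfl) this
  -- Step 5: `T_{β',γ'}(x₂) ≤ 0` by the mean value theorem for `x^{−a} T_{β',γ'}` on `[x₂, ξ]`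
  have hTx₂ : ((C 1 - C β' * X ^ a + C γ' * X ^ b - X ^ c : ℝ[X])).eval x₂ ≤ 0 := by
    have hmvt := div_pow_le_of_twist_nonneg (a := a) ((C 1 - C β' * X ^ a + C γ' * X ^ b - X ^ c : ℝ[X])) hx₂ hx₂ξ (fun p hp => by
      rw [twist_identity ha hb hc β' γ' p]; exact hτ'pos p hp)
    rw [hD₁, zero_mul] at hmvt
    have hexp : 0 < Real.exp (-(a : ℝ) * Real.log x₂) := Real.exp_pos _
    by_contra hcon
    push Not at hcon
    have := mul_pos hcon hexp
    linarith
  -- Step 6: compare the two tetranomials at `x₂`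
  rw [eval_tet] at hT₂ hTx₂
  have hxa : 0 < x₂ ^ a := pow_pos hx₂ _
  have hxb : 0 ≤ x₂ ^ b := (pow_pos hx₂ _).le
  -- β x₂^a = 1 + γ x₂^b − x₂^c ≤ 1 + γ' x₂^b − x₂^c ≤ β' x₂^a
  have h1 : β * x₂ ^ a ≤ β' * x₂ ^ a := by nlinarith [mul_le_mul_of_nonneg_right hγ hxb]
  exact le_of_mul_le_mul_right h1 hxa

/-- **The same, from the root count** (the census currency `#Z₊ ≥ 3` of `newton_cone`): if the normalised tetranomial has at least
three distinct positive roots, `γ ≤ γ'` and `(β', γ', ξ)` is an upper-branch double-root point, then `β ≤ β'`. [this work] -/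
theorem tetranomial_upper_staircase_of_card (ha : 0 < a) (hab : a < b) (hbc : b < c) (β γ β' γ' ξ : ℝ)
    (hZ : 3 ≤ (((C 1 - C β * X ^ a + C γ * X ^ b - X ^ c : ℝ[X])).roots.toFinset.filter (fun x => 0 < x)).card)
    (hγ : γ ≤ γ') (hξ : 0 < ξ)
    (hD₁ : ((C 1 - C β' * X ^ a + C γ' * X ^ b - X ^ c : ℝ[X])).eval ξ = 0) (hD₂ : ((C (-(a : ℝ)) + C (((b : ℝ) - a) * γ') * X ^ b - C ((c : ℝ) - a) * X ^ c : ℝ[X])).eval ξ = 0)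
    (hD₃ : (b : ℝ) * ((b : ℝ) - a) * γ' * ξ ^ b ≤ (c : ℝ) * ((c : ℝ) - a) * ξ ^ c) :
    β ≤ β' := by
  classical
  set s := ((C 1 - C β * X ^ a + C γ * X ^ b - X ^ c : ℝ[X])).roots.toFinset.filter (fun x => 0 < x) with hs
  have hT0 : (C 1 - C β * X ^ a + C γ * X ^ b - X ^ c : ℝ[X]) ≠ 0 := by
    intro h0
    rw [hs, h0, roots_zero, Multiset.toFinset_zero, Finset.filter_empty, Finset.card_empty] at hZ
    omega
  have hmem : ∀ x ∈ s, 0 < x ∧ ((C 1 - C β * X ^ a + C γ * X ^ b - X ^ c : ℝ[X])).eval x = 0 := by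
    intro x hx
    rw [hs, Finset.mem_filter, Multiset.mem_toFinset, mem_roots hT0, IsRoot.def] at hx
    exact ⟨hx.2, hx.1⟩
  have hne : s.Nonempty := Finset.card_pos.mp (by omega)
  set x₃ := s.max' hne with hx₃
  have hx₃s : x₃ ∈ s := Finset.max'_mem s hne
  set s₂ := s.erase x₃ with hs₂
  have hc₂ : 2 ≤ s₂.card := by rw [hs₂, Finset.card_erase_of_mem hx₃s]; omega
  have hne₂ : s₂.Nonempty := Finset.card_pos.mp (by omega)
  set x₂ := s₂.max' hne₂ with hx₂
  have hx₂s₂ : x₂ ∈ s₂ := Finset.max'_mem s₂ hne₂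
  set s₁ := s₂.erase x₂ with hs₁
  have hc₁ : 1 ≤ s₁.card := by rw [hs₁, Finset.card_erase_of_mem hx₂s₂]; omega
  have hne₁ : s₁.Nonempty := Finset.card_pos.mp (by omega)
  obtain ⟨x₁, hx₁s₁⟩ := hne₁
  have h12 : x₁ < x₂ := Finset.lt_max'_of_mem_erase_max' s₂ hne₂ hx₁s₁
  have hx₁s₂ : x₁ ∈ s₂ := Finset.mem_of_mem_erase hx₁s₁
  have h23 : x₂ < x₃ := Finset.lt_max'_of_mem_erase_max' s hne hx₂s₂
  have hx₂s : x₂ ∈ s := Finset.mem_of_mem_erase hx₂s₂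
  have hx₁s : x₁ ∈ s := Finset.mem_of_mem_erase hx₁s₂
  obtain ⟨hx₁, hT₁⟩ := hmem x₁ hx₁s
  obtain ⟨-, hT₂⟩ := hmem x₂ hx₂s
  obtain ⟨-, hT₃⟩ := hmem x₃ hx₃s
  exact tetranomial_upper_staircase ha hab hbc β γ β' γ' ξ x₁ x₂ x₃ hx₁ h12 h23 hT₁ hT₂ hT₃ hγ hξ hD₁ hD₂ hD₃

/-- **Reversal.**  If `T(x) = 1 − βx^a + γx^b − x^c` vanishes at `x > 0` then the REVERSED tetranomial
`1 − γ y^{c−b} + β y^{c−a} − y^c` vanishes at `y = x⁻¹` (`y^c · T(1/y)·(−1)`); so the lower branch / the `x ↦ 1/x` mirror rows of the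
T4 staircase are `tetranomial_upper_staircase` for the gaps `(c−b, c−a, c)` with `(β, γ)` swapped. [folklore] -/
theorem tetranomial_reverse_root (hab : a < b) (hbc : b < c) (β γ : ℝ) {x : ℝ} (hx : 0 < x)
    (hT : (C 1 - C β * X ^ a + C γ * X ^ b - X ^ c : ℝ[X]).eval x = 0) :
    (C 1 - C γ * X ^ (c - b) + C β * X ^ (c - a) - X ^ c : ℝ[X]).eval x⁻¹ = 0 := by
  rw [eval_tet] at hT
  have hxc : x ^ c ≠ 0 := pow_ne_zero _ hx.ne'
  simp only [eval_sub, eval_add, eval_mul, eval_C, eval_pow, eval_X]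
  have hxcb : x ^ (c - b) ≠ 0 := pow_ne_zero _ hx.ne'
  have hxca : x ^ (c - a) ≠ 0 := pow_ne_zero _ hx.ne'
  have pcb : x ^ (c - b) * x ^ b = x ^ c := by rw [← pow_add, show c - b + b = c by omega]
  have pca : x ^ (c - a) * x ^ a = x ^ c := by rw [← pow_add, show c - a + a = c by omega]
  have e1 : x⁻¹ ^ (c - b) = x ^ b / x ^ c := by
    rw [inv_pow, eq_div_iff hxc, ← pcb]
    field_simp
  have e2 : x⁻¹ ^ (c - a) = x ^ a / x ^ c := by
    rw [inv_pow, eq_div_iff hxc, ← pca]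
    field_simp
  have e3 : x⁻¹ ^ c = 1 / x ^ c := by rw [inv_pow, one_div]
  rw [e1, e2, e3]
  field_simp
  linarith

/-- **Three reversed roots.**  Three distinct positive roots of `T` give three distinct positive roots of the reversed tetranomial
(in the `#Z₊ ≥ 3` currency), so every staircase row on the other branch is again `tetranomial_upper_staircase_of_card`. [folklore] -/
theorem tetranomial_reverse_card (hab : a < b) (hbc : b < c) (β γ : ℝ)
    (hZ : 3 ≤ ((C 1 - C β * X ^ a + C γ * X ^ b - X ^ c : ℝ[X]).roots.toFinset.filter (fun x => 0 < x)).card) :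
    3 ≤ ((C 1 - C γ * X ^ (c - b) + C β * X ^ (c - a) - X ^ c : ℝ[X]).roots.toFinset.filter (fun x => 0 < x)).card := by
  classical
  set T := (C 1 - C β * X ^ a + C γ * X ^ b - X ^ c : ℝ[X]) with hTdef
  set R := (C 1 - C γ * X ^ (c - b) + C β * X ^ (c - a) - X ^ c : ℝ[X]) with hRdef
  have hT0 : T ≠ 0 := by
    intro h0
    rw [h0, roots_zero, Multiset.toFinset_zero, Finset.filter_empty, Finset.card_empty] at hZ
    omega
  have hR0 : R ≠ 0 := by
    intro h0
    have h1 : R.eval 0 = 0 := by rw [h0, eval_zero]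
    have hc : c ≠ 0 := by omega
    have hcb : c - b ≠ 0 := by omega
    have hca : c - a ≠ 0 := by omega
    rw [hRdef] at h1
    simp [zero_pow hc, zero_pow hcb, zero_pow hca] at h1
  -- the injection `x ↦ x⁻¹` from the positive roots of `T` into those of `R`
  have hmap : ∀ x ∈ T.roots.toFinset.filter (fun x => 0 < x), x⁻¹ ∈ R.roots.toFinset.filter (fun x => 0 < x) := by
    intro x hx
    rw [Finset.mem_filter, Multiset.mem_toFinset, mem_roots hT0, IsRoot.def] at hx
    rw [Finset.mem_filter, Multiset.mem_toFinset, mem_roots hR0, IsRoot.def]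
    exact ⟨tetranomial_reverse_root hab hbc β γ hx.2 hx.1, inv_pos.mpr hx.2⟩
  calc 3 ≤ (T.roots.toFinset.filter (fun x => 0 < x)).card := hZ
    _ ≤ (R.roots.toFinset.filter (fun x => 0 < x)).card :=
        Finset.card_le_card_of_injOn (fun x => x⁻¹) hmap (fun x _ y _ h => inv_injective h)

end Analysis

end Summit.ValiantsHypothesis.ValiantsHypothesis.Theorems.LacunarySymmetroidMatrixDescartes.Census.T4
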